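import Summits.QuantumFields.YangMills.Theorems.CurvatureKernelBound.Negative.L1Extension

/-!
# `CurvatureKernelBound` — negative lemmas, `ℓ¹` witness IV: translations, signed permutations, swap, hermiticity

Supports crux item `stmt-QuantumFields-11687` (`PencilRigidity.CurvatureKernelBound`). Standing disprover's negative
lemmas (refuter, cdisprove cycle 3), ORDER-INSUFFICIENCY WITH REGULARITY chain `L1Kernel → L1Flat → L1Extension →
L1Package → L1RPKernel → L1RP → L1Main`, culminating in `L1Witness.not_axialGrowthOfTwoPointPackage`: the two-point
shadow of `W₁ ∖ lattice` plus a representing kernel continuous off `0` do NOT imply the axial growth bound of Stub E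
(`AxialGrowth`) of line `sixteen-charts-analytic-kernel`. No conclusion below asserts a Theses statement positively.

On `⁰𝒮` the functional `T` is invariant under diagonal translations (`T_translateMulti`), under every signed
permutation of the coordinates (`T_linActMulti`; `l1_signedPerm`: an isometry with `R e_i = ±e_{σ i}` preserves
`‖·‖₁` — `σ` is a bijection and `(R x)_{σ i} = ε_i x_i` by `⟪R x, e_{σ i}⟫ = ⟪x, R⁻¹ e_{σ i}⟫`), under the swap of the
two points (`T_permTest_swap`, evenness of `K`), and hermitian (`T_hermitian : T F = conj T(ΘF*)`, via the
substitution `x ↦ (θ x) ∘ swap`, `θ` being a signed permutation). [folklore]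
-/

open scoped BigOperators Topology SchwartzMap
open MeasureTheory Filter Set Real
open Literature.MathematicalPhysics.QuantumLattice Literature.MathematicalPhysics.AQFT

noncomputable section

namespace Summit.QuantumFields.YangMills.Theorems.CurvatureKernelBound.Negative

namespace L1Witness

/-! ### The package of `T` on `⁰𝒮`: translations, signed permutations, swap symmetry, hermiticity -/

section Package

/-- Auxiliary fact `T_translateMulti` of the `ℓ¹`-witness construction (see the module docstring). [folklore] -/
theorem T_translateMulti (a : E4) {F : 𝓢((Fin 2 → E4), ℂ)} (hF : IsOffDiagonal F) :
    T (translateMulti a F) = T F := by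
  rw [T_eq_integral (isOffDiagonal_translateMulti hF a), T_eq_integral hF]
  have h := integral_sub_right_eq_self (μ := volume) (fun x : Fin 2 → E4 => KC x * F x) (fun _ => a)
  refine Eq.trans (integral_congr_ae (ae_of_all _ fun x => ?_)) h
  simp only [translateMulti_apply, KC_apply, Pi.sub_apply, sub_sub_sub_cancel_right]
  rfl

/-- A signed permutation of the coordinates (`R e_i = ± e_j` for all `i`) preserves the `ℓ¹` norm. -/
theorem l1_signedPerm (R : E4 ≃ₗᵢ[ℝ] E4)
    (hR : ∀ i : Fin 4, ∃ j : Fin 4, R (EuclideanSpace.single i 1) = EuclideanSpace.single j 1 ∨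
      R (EuclideanSpace.single i 1) = -EuclideanSpace.single j 1) (x : E4) :
    l1 (R x) = l1 x := by
  classical
  choose σ hσ using hR
  have hε : ∀ i, ∃ ε : ℝ, (ε = 1 ∨ ε = -1) ∧
      R (EuclideanSpace.single i 1) = ε • EuclideanSpace.single (σ i) 1 := by
    intro i
    rcases hσ i with h | h
    · exact ⟨1, Or.inl rfl, by rw [h, one_smul]⟩
    · exact ⟨-1, Or.inr rfl, by rw [h, neg_one_smul]⟩
  choose ε hε1 hεR using hε
  have hεsq : ∀ i, ε i * ε i = 1 := fun i => by rcases hε1 i with h | h <;> simp [h]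
  have hεabs : ∀ i, |ε i| = 1 := fun i => by rcases hε1 i with h | h <;> simp [h]
  -- coordinates as inner products with the standard basis
  have hcoord : ∀ (v : E4) (j : Fin 4), v j = inner ℝ v (EuclideanSpace.single j (1 : ℝ)) := by
    intro v j
    rw [EuclideanSpace.inner_single_right]
    simp
  -- σ is injective, hence bijective
  have hσinj : Function.Injective σ := by
    intro i i' h
    by_contra hne
    have h2 : R (EuclideanSpace.single i' 1) = ε i' • EuclideanSpace.single (σ i) 1 := by
      rw [hεR i', h]
    have key : R ((ε i * ε i') • EuclideanSpace.single i' 1 - EuclideanSpace.single i 1) = 0 := by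
      rw [map_sub, map_smul, hεR i, h2, smul_smul, mul_assoc, hεsq i', mul_one, sub_self]
    have key2 : ((ε i * ε i') • EuclideanSpace.single i' (1 : ℝ) - EuclideanSpace.single i 1 : E4) = 0 :=
      R.injective (by rw [key, map_zero])
    have h3 := congrArg (fun v : E4 => v i) key2
    simp [hne] at h3
  have hσbij : Function.Bijective σ := Finite.injective_iff_bijective.1 hσinj
  set e : Fin 4 ≃ Fin 4 := Equiv.ofBijective σ hσbij with he
  -- R⁻¹ e_{σ i} = ε_i e_i
  have hsymm : ∀ i, R.symm (EuclideanSpace.single (σ i) 1) = ε i • EuclideanSpace.single i 1 := by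
    intro i
    apply R.injective
    rw [LinearIsometryEquiv.apply_symm_apply, map_smul, hεR i, smul_smul, hεsq i, one_smul]
  -- the coordinates of R x
  have hRx : ∀ i, R x (σ i) = ε i * x i := by
    intro i
    rw [hcoord (R x) (σ i), ← LinearIsometryEquiv.inner_map_map R.symm (R x),
      LinearIsometryEquiv.symm_apply_apply, hsymm i, inner_smul_right, ← hcoord x i]
  calc l1 (R x) = ∑ j, |R x j| := rfl
    _ = ∑ i, |R x (e i)| := (Equiv.sum_comp e (fun j => |R x j|)).symm
    _ = ∑ i, |x i| := by
        refine Finset.sum_congr rfl fun i _ => ?_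
        rw [show e i = σ i from rfl, hRx i, abs_mul, hεabs i, one_mul]
    _ = l1 x := rfl

/-- Auxiliary fact `Kw_signedPerm` of the `ℓ¹`-witness construction (see the module docstring). [folklore] -/
theorem Kw_signedPerm (R : E4 ≃ₗᵢ[ℝ] E4)
    (hR : ∀ i : Fin 4, ∃ j : Fin 4, R (EuclideanSpace.single i 1) = EuclideanSpace.single j 1 ∨
      R (EuclideanSpace.single i 1) = -EuclideanSpace.single j 1) (x : E4) :
    Kw (R x) = Kw x := by
  rw [Kw, l1_signedPerm R hR, Kw]

/-- Auxiliary fact `T_linActMulti` of the `ℓ¹`-witness construction (see the module docstring). [folklore] -/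
theorem T_linActMulti (R : E4 ≃ₗᵢ[ℝ] E4)
    (hR : ∀ i : Fin 4, ∃ j : Fin 4, R (EuclideanSpace.single i 1) = EuclideanSpace.single j 1 ∨
      R (EuclideanSpace.single i 1) = -EuclideanSpace.single j 1)
    {F : 𝓢((Fin 2 → E4), ℂ)} (hF : IsOffDiagonal F) :
    T (linActMulti R F) = T F := by
  rw [T_eq_integral (isOffDiagonal_linActMulti hF R), T_eq_integral hF,
    ← integral_comp_isometry R (fun x => KC x * linActMulti R F x)]
  refine integral_congr_ae (ae_of_all _ fun x => ?_)
  simp only [linActMulti_apply, KC_apply, LinearIsometryEquiv.symm_apply_apply, ← map_sub,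
    Kw_signedPerm R hR]

/-- Swap symmetry (the `n = 2` content of E3). -/
theorem T_permTest_swap {F : 𝓢((Fin 2 → E4), ℂ)} (hF : IsOffDiagonal F) :
    T (permTest (Equiv.swap 0 1) F) = T F := by
  rw [T_eq_integral (isOffDiagonal_permTest hF _), T_eq_integral hF,
    ← integral_comp_perm (Equiv.swap 0 1) (fun x => KC x * permTest (Equiv.swap 0 1) F x)]
  refine integral_congr_ae (ae_of_all _ fun x => ?_)
  have hswap : (x ∘ Equiv.swap 0 1) ∘ Equiv.swap 0 1 = x := by
    funext i; simp [Function.comp_apply, Equiv.swap_apply_self]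
  simp only [permTest_apply, KC_apply, hswap, Function.comp_apply, Equiv.swap_apply_left,
    Equiv.swap_apply_right, ← Kw_neg (x 1 - x 0), neg_sub]

/-- `θ e₀ = -e₀`. -/
theorem timeReflection_single_zero :
    timeReflection 4 (EuclideanSpace.single 0 (1 : ℝ)) = -EuclideanSpace.single 0 1 := by
  ext j
  by_cases hj : j = 0
  · subst hj; simp [timeReflection_apply]
  · simp [timeReflection_apply, hj]

/-- `θ e_i = e_i` for `i ≠ 0`. -/
theorem timeReflection_single_ne {i : Fin 4} (hi : i ≠ 0) :
    timeReflection 4 (EuclideanSpace.single i (1 : ℝ)) = EuclideanSpace.single i 1 := by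
  ext j
  by_cases hj : j = 0
  · subst hj; simp [timeReflection_apply, Ne.symm hi]
  · simp [timeReflection_apply, hj]

/-- Time reflection is a signed permutation. -/
theorem timeReflection_signedPerm : ∀ i : Fin 4, ∃ j : Fin 4,
    timeReflection 4 (EuclideanSpace.single i 1) = EuclideanSpace.single j 1 ∨
      timeReflection 4 (EuclideanSpace.single i 1) = -EuclideanSpace.single j 1 := by
  intro i
  refine ⟨i, ?_⟩
  by_cases hi : i = 0
  · right; subst hi; exact timeReflection_single_zero
  · left; exact timeReflection_single_ne hi

/-- Auxiliary fact `Kw_timeReflection` of the `ℓ¹`-witness construction (see the module docstring). [folklore] -/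
theorem Kw_timeReflection (w : E4) : Kw (timeReflection 4 w) = Kw w :=
  Kw_signedPerm _ timeReflection_signedPerm w

/-- Auxiliary fact `comp_rev_eq_comp_swap` of the `ℓ¹`-witness construction (see the module docstring). [folklore] -/
theorem comp_rev_eq_comp_swap (x : Fin 2 → E4) :
    (fun i => x (Fin.rev i)) = x ∘ Equiv.swap 0 1 := by
  funext i
  fin_cases i <;> rfl

/-- Hermiticity shadow (E0): `T F = conj T(ΘF*)` on `⁰𝒮` (in particular on time-ordered `F`). -/
theorem T_hermitian {F : 𝓢((Fin 2 → E4), ℂ)} (hF : IsOffDiagonal F) :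
    T F = (starRingEnd ℂ) (T (osAdjoint F)) := by
  rw [T_eq_integral (isOffDiagonal_osAdjoint hF), T_eq_integral hF, ← integral_conj]
  have hint : ∀ x : Fin 2 → E4, (starRingEnd ℂ) (KC x * osAdjoint F x) =
      KC x * F (fun i => timeReflection 4 (x (Fin.rev i))) := by
    intro x
    simp [osAdjoint_apply, KC_apply, Complex.conj_ofReal]
  simp_rw [hint]
  -- step 1: substitute `x ↦ θ ∘ x`
  rw [← integral_comp_isometry (timeReflection 4)
    (fun x : Fin 2 → E4 => KC x * F (fun i => timeReflection 4 (x (Fin.rev i))))]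
  have h2 : ∀ x : Fin 2 → E4, KC (fun i => timeReflection 4 (x i)) *
      F (fun i => timeReflection 4 (timeReflection 4 (x (Fin.rev i)))) =
        KC x * F (x ∘ Equiv.swap 0 1) := by
    intro x
    simp only [KC_apply, timeReflection_timeReflection, ← map_sub, Kw_timeReflection,
      ← comp_rev_eq_comp_swap]
  simp_rw [h2]
  -- step 2: substitute `x ↦ x ∘ swap`
  have h3 := integral_comp_perm (Equiv.swap 0 1)
    (fun x : Fin 2 → E4 => KC (x ∘ Equiv.swap 0 1) * F x)
  have h4 : ∀ x : Fin 2 → E4, (x ∘ Equiv.swap 0 1) ∘ Equiv.swap 0 1 = x := by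
    intro x; funext i; simp
  simp only [h4] at h3
  rw [h3]
  refine integral_congr_ae (ae_of_all _ fun x => ?_)
  simp only [KC_apply, Function.comp_apply, Equiv.swap_apply_left, Equiv.swap_apply_right]
  rw [← Kw_neg, neg_sub]

end Package

end L1Witness

end Summit.QuantumFields.YangMills.Theorems.CurvatureKernelBound.Negative
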